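import Summits.PneNP.PneNP.Theorems.Nc03AvoidResidualCoreCandFewHeadsRungFP
import Summits.PneNP.PneNP.Theorems.MajLocalAvoidFPDecode

/-!
# A polynomial-time DECODER of `LocalMap.encode` for arbitrary `k`-local maps (all tables, general `k`)

Cell pnp-ideate, rung F-N2a and successors (`--supports stmt-PneNP-19007`).  The FP leaves of the
range-avoidance ladder (`Literature.Computability.Complexity.LocalAvoidLinearFP k Q`) quantify over ONE
string function on the instance code
`LocalMap.encode I = 1ⁿ0 · 1ᵐ0 · ∏_{j<m} (T_j · ∏_{i<k} 1^{v_{j,i}} 0)` (`T_j` = the `2ᵏ` table bits of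
output `j`, `v_{j,i}` its positions).  The decoders in the tree so far exploit a CONSTANT table block
(pure `CAND`: `Nc03AvoidResidualCoreCandFewHeadsRungFPDecode`; all-`MAJ_k`: `MajLocalAvoidFPDecode`).  For
sub-families with VARYING tables (general LTF tables, sign-degree classes) this file provides the
general decoder, typed in the `CodeFP` algebra:

* `parseOne k r = (r ↾ 2ᵏ, first k run-length tokens of r ⇂ 2ᵏ)` reads the front block of a body string,
  `skipBlock k r` drops it (its length is `2ᵏ + Σ_i (v_i + 1)`), `skipRun`/`blockAt` reach block `j` by
  `j` skips — so the only fold whose accumulator needs a size bound is a fold of a SHRINKING string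
  (`length_skipRun_le`), the per-block outputs being assembled by `CodeFP.map`;
* `decode k w`: header tokens `n, m` (`runs`), body `w ⇂ (n + m + 2)`, blocks `0 … m-1`;
* `decode_encode : decode k (encode I) = [(tabOf I j, rowOf I j)]_{j<m}` for EVERY `I : LocalMap k n m`;
* `codeFP_decode : CodeFP strE (rawE (pairE strE (rawE natE))) (decode k)`.

Restricted-model algorithmic infrastructure; no bearing on `P` versus `NP`.
-/

set_option linter.dupNamespace false -- `Summit.PneNP.PneNP.…`: summit = sub-problem name (D-0017 single-conjunct layout)

namespace Summit.PneNP.PneNP.Theorems.LocalMapDecodeFP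

open Literature.Computability.Complexity
open Summit.PneNP.PneNP.Theorems.Nc03AvoidResidualCoreCandFewHeadsRungFP
open Summit.PneNP.PneNP.Theorems.MajLocalAvoidFP

variable {k n m : ℕ}

/-! ## The code of an instance, block by block -/

/-- The `2ᵏ` table bits of output `j` (row `p < 2ᵏ` ↦ the table at the bit tuple of `p`). -/
def tabOf (I : LocalMap k n m) (j : Fin m) : List Bool :=
  List.ofFn fun p : Fin (2 ^ k) => I.table j fun i : Fin k => p.val.testBit i.val

/-- The table block has `2ᵏ` bits. -/
@[simp] theorem length_tabOf (I : LocalMap k n m) (j : Fin m) : (tabOf I j).length = 2 ^ k := by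
  simp [tabOf]

/-- The unary codes of the positions of output `j`. -/
def posCode (I : LocalMap k n m) (j : Fin m) : List Bool := ((rowOf I j).map LocalMap.unaryCode).flatten

/-- Length of a run of unary codes: `Σ_i (v_i + 1)`. -/
theorem length_flatten_unaryCode (L : List ℕ) : ((L.map LocalMap.unaryCode).flatten).length = L.sum + L.length := by
  induction L with
  | nil => simp
  | cons a L ih =>
    rw [List.map_cons, List.flatten_cons, List.length_append, ih]
    simp [LocalMap.unaryCode]
    omega

/-- The positions of output `j` take `Σ_i v_{j,i} + k` bits. -/
theorem length_posCode (I : LocalMap k n m) (j : Fin m) : (posCode I j).length = (rowOf I j).sum + k := by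
  rw [posCode, length_flatten_unaryCode, length_rowOf]

/-- The code block of output `j`: table bits, then positions. -/
def blockOf (I : LocalMap k n m) (j : Fin m) : List Bool := tabOf I j ++ posCode I j

/-- `LocalMap.encode` = the two header codes followed by the per-output blocks. -/
theorem encode_eq (I : LocalMap k n m) :
    I.encode = LocalMap.unaryCode n ++ LocalMap.unaryCode m ++ ((List.finRange m).map (blockOf I)).flatten := by
  have hb : (fun j : Fin m => (List.ofFn fun p : Fin (2 ^ k) => I.table j fun i : Fin k => p.val.testBit i.val) ++
      (List.ofFn fun i : Fin k => LocalMap.unaryCode (I.vars j i).val).flatten) = blockOf I := by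
    funext j
    rw [blockOf, tabOf, posCode, rowOf, List.map_ofFn]
    rfl
  rw [LocalMap.encode, List.ofFn_eq_map, hb]

/-- The header tokens: `runs (1ᵃ0 · 1ᵇ0 · w) = a, b, runs w`. -/
theorem runs_header (a b : ℕ) (w : List Bool) :
    runs (LocalMap.unaryCode a ++ LocalMap.unaryCode b ++ w) = a :: b :: runs w := by
  rw [runs, runs, List.append_assoc, runState_unaryCode, runState_unaryCode, List.nil_append,
    List.singleton_append]
  have h := runState_prefix w [a, b] [] 0
  rw [List.append_nil] at h
  rw [h]
  rfl

/-- The positions' codes contribute exactly the positions as tokens. -/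
theorem runs_posCode_append (I : LocalMap k n m) (j : Fin m) (w : List Bool) :
    runs (posCode I j ++ w) = rowOf I j ++ runs w := by
  rw [runs, runs, posCode, runState_unaryCodes, List.nil_append]
  have h := runState_prefix w (rowOf I j) [] 0
  rw [List.append_nil] at h
  rw [h]

/-! ## Parsing the body -/

/-- The front block of a body string, parsed: (table bits, positions). -/
def parseOne (k : ℕ) (r : List Bool) : List Bool × List ℕ := (r.take (2 ^ k), (runs (r.drop (2 ^ k))).take k)

/-- Dropping the front block of a body string. -/
def skipBlock (k : ℕ) (r : List Bool) : List Bool :=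
  (r.drop (2 ^ k)).drop (((runs (r.drop (2 ^ k))).take k).sum + k)

/-- Dropping `|u|` front blocks. -/
def skipRun (k : ℕ) (r : List Bool) (u : List Unit) : List Bool := u.foldl (fun r _ => skipBlock k r) r

/-- Block number `|u|` of a body string, parsed. -/
def blockAt (k : ℕ) (r : List Bool) (u : List Unit) : List Bool × List ℕ := parseOne k (skipRun k r u)

/-- Header token `0`: the number of inputs `n`. -/
def hdrN (w : List Bool) : ℕ := (runs w).getD 0 0

/-- Header token `1`: the number of outputs `m`. -/
def hdrM (w : List Bool) : ℕ := (runs w).getD 1 0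

/-- The body: the code after the two header codes. -/
def bodyOf (w : List Bool) : List Bool := w.drop (hdrN w + hdrM w + 2)

/-- **THE DECODER**: the `m` blocks of the body, parsed (block `j` reached by `min j m = j` skips). -/
def decode (k : ℕ) (w : List Bool) : List (List Bool × List ℕ) :=
  (List.range (hdrM w)).map fun j => blockAt k (bodyOf w) (List.replicate (min j (hdrM w)) ())

/-- The decoded form of an instance: per output, its table bits and its positions. -/
def outsOf (I : LocalMap k n m) : List (List Bool × List ℕ) := (List.finRange m).map fun j => (tabOf I j, rowOf I j)

/-- Parsing a genuine front block. -/
theorem parseOne_blockOf (I : LocalMap k n m) (j : Fin m) (w : List Bool) :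
    parseOne k (blockOf I j ++ w) = (tabOf I j, rowOf I j) := by
  rw [parseOne, blockOf, List.append_assoc, List.take_left' (length_tabOf I j), List.drop_left' (length_tabOf I j),
    runs_posCode_append, List.take_left' (length_rowOf I j)]

/-- Skipping a genuine front block. -/
theorem skipBlock_blockOf (I : LocalMap k n m) (j : Fin m) (w : List Bool) : skipBlock k (blockOf I j ++ w) = w := by
  rw [skipBlock, blockOf, List.append_assoc, List.drop_left' (length_tabOf I j), runs_posCode_append,
    List.take_left' (length_rowOf I j), ← length_posCode I j, List.drop_left]

/-- Skipping `j` genuine blocks. -/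
theorem skipRun_blocks (I : LocalMap k n m) (w : List Bool) : ∀ (j : ℕ) (L : List (Fin m)), j ≤ L.length →
    skipRun k ((L.map (blockOf I)).flatten ++ w) (List.replicate j ()) = ((L.drop j).map (blockOf I)).flatten ++ w := by
  intro j
  induction j with
  | zero => intro L _; rfl
  | succ j ih =>
    intro L hL
    obtain ⟨x, L, rfl⟩ := List.exists_cons_of_length_pos (by omega : 0 < L.length)
    rw [skipRun, List.replicate_succ, List.foldl_cons, List.map_cons, List.flatten_cons, List.append_assoc,
      skipBlock_blockOf, ← skipRun, ih L (by simpa using hL), List.drop_succ_cons]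

/-- **Block `j` of a genuine body is output `j`, decoded.** -/
theorem blockAt_blocks (I : LocalMap k n m) (L : List (Fin m)) (j : ℕ) (hj : j < L.length) :
    blockAt k ((L.map (blockOf I)).flatten) (List.replicate j ()) = (tabOf I L[j], rowOf I L[j]) := by
  have h := skipRun_blocks I [] j L hj.le
  rw [List.append_nil, List.append_nil] at h
  rw [blockAt, h, List.drop_eq_getElem_cons hj, List.map_cons, List.flatten_cons, parseOne_blockOf]

/-- Header token `0` of a code is `n`. -/
theorem hdrN_encode (I : LocalMap k n m) : hdrN I.encode = n := by
  rw [hdrN, encode_eq, runs_header]; rfl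

/-- Header token `1` of a code is `m`. -/
theorem hdrM_encode (I : LocalMap k n m) : hdrM I.encode = m := by
  rw [hdrM, encode_eq, runs_header]; rfl

/-- The body of a code is the concatenation of the output blocks. -/
theorem bodyOf_encode (I : LocalMap k n m) : bodyOf I.encode = ((List.finRange m).map (blockOf I)).flatten := by
  rw [bodyOf, hdrN_encode, hdrM_encode, encode_eq]
  exact List.drop_left' (by simp [LocalMap.unaryCode]; omega)

/-- **Decoding**: on the code of ANY `k`-local map the decoder returns its outputs (table bits, positions). -/
theorem decode_encode (I : LocalMap k n m) : decode k I.encode = outsOf I := by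
  rw [decode, hdrM_encode, bodyOf_encode, outsOf, ← List.map_coe_finRange_eq_range, List.map_map]
  refine List.map_congr_left fun j _ => ?_
  rw [Function.comp_apply, Nat.min_eq_left j.isLt.le,
    blockAt_blocks I _ _ (by rw [List.length_finRange]; exact j.isLt), List.getElem_finRange]
  rfl

/-! ## Size: skipping only shortens -/

/-- A skip shortens the string. -/
theorem length_skipBlock_le (k : ℕ) (r : List Bool) : (skipBlock k r).length ≤ r.length := by
  simp only [skipBlock, List.length_drop]
  exact (Nat.sub_le _ _).trans (Nat.sub_le _ _)

/-- Skips shorten the string. -/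
theorem length_skipRun_le (k : ℕ) (u : List Unit) : ∀ r : List Bool, (skipRun k r u).length ≤ r.length := by
  induction u with
  | nil => intro r; exact le_rfl
  | cons x u ih => intro r; exact (ih _).trans (length_skipBlock_le k r)

/-! ## Typing in the `CodeFP` algebra -/

section PolyTime

open CodeFP Polynomial

/-- Code of a decoded output: table bits as a plain string, positions as binary numerals. -/
abbrev outE : List Bool × List ℕ → List Bool := pairE strE (rawE natE)

/-- Unary-to-binary on a raw list of numerals. -/
theorem codeFP_unToNatList : CodeFP (rawE unE) (rawE natE) (fun l => l) :=
  (map₀ natOfUn).congr fun l => List.map_id l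

/-- The first `k` tokens after the table block are computed in polynomial time. -/
theorem codeFP_posToks (k : ℕ) : CodeFP strE (rawE unE) (fun r => (runs (r.drop (2 ^ k))).take k) :=
  ((rawTakeUn unE).comp ((const strE k).pair (codeFP_runs.comp
    (strDrop.comp ((const strE (2 ^ k : ℕ)).pair (CodeFP.id strE)))))).congr fun _ => rfl

/-- Parsing the front block is polynomial time. -/
theorem codeFP_parseOne (k : ℕ) : CodeFP strE outE (parseOne k) :=
  ((strTake.comp ((const strE (2 ^ k : ℕ)).pair (CodeFP.id strE))).pair
    (codeFP_unToNatList.comp (codeFP_posToks k))).congr fun _ => rfl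

/-- Skipping the front block is polynomial time. -/
theorem codeFP_skipBlock (k : ℕ) : CodeFP strE strE (skipBlock k) :=
  (strDrop.comp ((unAdd.comp ((unSum.comp (codeFP_posToks k)).pair (const strE k))).pair
    (strDrop.comp ((const strE (2 ^ k : ℕ)).pair (CodeFP.id strE))))).congr fun _ => rfl

/-- Skipping blocks is polynomial time (a fold of a shrinking string). -/
theorem codeFP_skipRun (k : ℕ) : CodeFP (pairE strE (rawE unitE)) strE (fun p => skipRun k p.1 p.2) := by
  have h := CodeFP.foldl (σ := List Bool) (eσ := strE) (α := Unit) (eα := unitE) (β := List Bool) (eβ := strE)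
    (step := fun _ _ r => skipBlock k r) (init := fun s => s)
    ((codeFP_skipBlock k).comp (snd strE (pairE unitE strE)).snd') (CodeFP.id strE) X
    (fun s l₁ l₂ => by
      have h1 := length_skipRun_le k l₁ s
      rw [skipRun] at h1
      simp only [eval_X, pairE_apply, length_boolPair, strE, id_eq]
      omega)
  exact h.congr fun _ => rfl

/-- The decoder on (body, `m`) is polynomial time. -/
theorem codeFP_decodeBody (k : ℕ) : CodeFP (pairE strE unE) (rawE outE)
    (fun σ => (List.range σ.2).map fun j => blockAt k σ.1 (List.replicate (min j σ.2) ())) := by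
  have hrep : CodeFP (pairE (pairE strE unE) natE) (rawE unitE) (fun t => List.replicate (min t.2 t.1.2) ()) :=
    (replicateUnit.comp (unOfNatMin.comp ((fst (pairE strE unE) natE).snd'.pair (snd (pairE strE unE) natE)))).congr
      fun _ => rfl
  have hitem : CodeFP (pairE (pairE strE unE) natE) outE (fun t => blockAt k t.1.1 (List.replicate (min t.2 t.1.2) ())) :=
    ((codeFP_parseOne k).comp ((codeFP_skipRun k).comp ((fst (pairE strE unE) natE).fst'.pair hrep))).congr fun _ => rfl
  exact ((map hitem).comp ((CodeFP.id (pairE strE unE)).pair (urange.comp (snd strE unE)))).congr fun _ => rfl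

/-- Header token `0` is polynomial time. -/
theorem codeFP_hdrN : CodeFP strE unE hdrN :=
  (codeFP_getTok.comp (codeFP_runs.pair (const strE (0 : ℕ)))).congr fun _ => rfl

/-- Header token `1` is polynomial time. -/
theorem codeFP_hdrM : CodeFP strE unE hdrM :=
  (codeFP_getTok.comp (codeFP_runs.pair (const strE (1 : ℕ)))).congr fun _ => rfl

/-- The body is polynomial time. -/
theorem codeFP_bodyOf : CodeFP strE strE bodyOf :=
  (strDrop.comp ((unAdd.comp ((unAdd.comp (codeFP_hdrN.pair codeFP_hdrM)).pair (const strE (2 : ℕ)))).pair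
    (CodeFP.id strE))).congr fun _ => rfl

/-- **The decoder is polynomial time.** -/
theorem codeFP_decode (k : ℕ) : CodeFP strE (rawE outE) (decode k) :=
  ((codeFP_decodeBody k).comp (codeFP_bodyOf.pair codeFP_hdrM)).congr fun _ => rfl

end PolyTime

end Summit.PneNP.PneNP.Theorems.LocalMapDecodeFP
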